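import Summits.Ventures.HSemireg.WedgeHankelRecurrenceGaussZerosWeyl

/-!
# Venture HSemireg — **THE ASSOCIATED POLYNOMIALS OF ORDER `i + 1`, THEIR CASORATIAN WITH `q`, AND THE RANK-ONE SECULAR IDENTITY**: for the recurrence `Q` with the shifted coefficients
# `(a_{n+i+1}, b_{n+i+1})`, `q_{m+i+2} Q_m − q_{m+i+1} Q_{m+1} = −(b_{i+1}⋯b_{m+i+1}) q_i`; raising ONE diagonal coefficient `a_i ↦ a_i + c` changes `q_{m+i+1}` into `q_{m+i+1} − c q_i Q_m`,
# so at a zero `ξ` of `q_N` (`N = m + i + 2`) the perturbed polynomial takes the value `q'_N(ξ) = −c (b_{i+1}⋯b_{N−1}) q_i(ξ)² ∕ q_{N−1}(ξ)`: a zero of `q_N` stays a zero exactly when `q_i`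
# vanishes there, the rank-one interlacing of N346 is STRICT when `q_i` has no zero in common with `q_N`, and it is NOT strict in general (typed example: `a = (0, a_1, 0)`, the middle zero of `q_3`
# is `0` for every `a_1`)

HONEST FRAMING. Part of the Lean index of the computation cell `pub-hsemireg` (seat p10 gen 45, Sunday typer «UNIFORM-IN-n»).  Real polynomials and finite products only; no variety, no cohomology
theory, no sheaf, no Ext group and no semiregularity map is constructed here; nothing here says that HC / HC_CM / HC_AV holds; no Literature fact (unproved `Prop`) is declared or used.  Custodian
versions as in `WedgeHankelSiegelIdeal` (1/3).
SOURCES (cited).  T. S. Chihara, *An Introduction to Orthogonal Polynomials* (1978) Ch. III §4 (associated ∕ numerator polynomials of order `c`, the Wronskian-type identities (4.3)–(4.6));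
W. Van Assche, *Orthogonal polynomials, associated polynomials and functions of the second kind*, J. Comput. Appl. Math. 37 (1991) 237–249, §2; G. H. Golub, *Some modified matrix eigenvalue
problems*, SIAM Rev. 15 (1973) 318–334, §5 (the secular equation of a rank-one modification); J. H. Wilkinson, *The Algebraic Eigenvalue Problem* (1965) Ch. 2 §§39–41.
PROOF TYPED HERE.  The Casoratian `W_m = q_{m+i+2} Q_m − q_{m+i+1} Q_{m+1}` satisfies `W_{m+1} = b_{m+i+2} W_m`, `W_0 = −b_{i+1} q_i`; the difference `D_n = q'_n − q_n` vanishes for `n ≤ i`,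
equals `−c q_i` at `n = i + 1` and solves the recurrence from there, hence `D_{m+i+1} = −c q_i Q_m`; at a zero of `q_N` the Casoratian gives `q_{N−1} Q_{N−i−1} = (∏ b) q_i`, and
`q_{N−1} ≠ 0` there (N277 `recurrence_no_common_root`).  Strictness: a common zero of `q_N` and `q'_N` forces `q_i = 0` there; N346 `zeros_rank_one_interlace` gives the weak inequalities.
DEDUP DISCLOSURE (`rg -n 'associated|casoratian|secular|numerator' Summits/Ventures/HSemireg`, 2026-09-03): N281 `GaussSecondKind` treats the order-ONE numerator polynomials `r` (`r_0 = 0`,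
`r_1 = 1`) and their Casoratian with `q` (N337 `convergent_sub_convergent_eq`); N338 uses the reversed recurrence; the general order and the rank-one secular identity are new.  The 9 names
below: 0 hits tree-wide.

WHAT IS IN THE TREE.  N277 `recurrence_no_common_root`; N346 `zeros_rank_one_interlace`; N274 ∕ N278 the recurrence hypotheses' shape.
THIS FILE (namespace `Summit.Ventures.HSemireg.Wedge.HankelOuter` continued; CHAINED on N346 (import); 0 definitions):
* §1112 **`associated_casoratian`** (`q_{m+i+2} Q_m − q_{m+i+1} Q_{m+1} = −C(b_{i+1}⋯b_{m+i+1}) q_i`), `rank_one_perturbation_eq_below` (`q'_n = q_n`, `n ≤ i`), **`rank_one_perturbation_eq`**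
  (`q'_{m+i+1} = q_{m+i+1} − C c · q_i · Q_m`), `associated_eval_at_zero` (`q_{m+i+2}(ξ) = 0 ⇒ q_{m+i+1}(ξ) Q_{m+1}(ξ) = (∏ b) q_i(ξ)`), **`rank_one_secular_value`**
  (`q'_N(ξ) q_{N−1}(ξ) = −c (∏ b) q_i(ξ)²` and `q_{N−1}(ξ) ≠ 0`), **`rank_one_fixed_zero_iff`** (`q'_N(ξ) = 0 ↔ q_i(ξ) = 0` for `c ≠ 0`), **`zeros_rank_one_strict_interlace`**
  (`q_i(x_k) ≠ 0` for all `k` ⇒ `x_k < y_k < x_{k+1}`), `rank_one_example_eval_zero` (`a_0 = a_2 = 0 ⇒ q_3(0) = 0` whatever `a_1`), **`rank_one_example_middle_zero`** (and `0` is the MIDDLE zero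
  of `q_3`: raising `a_1` does not move it).
CAVEATS.  Recurrence algebra; the strict statement needs `b > 0`.  Nothing Ext-side.  New names only.
-/

open Module Polynomial
open scoped Matrix Polynomial

namespace Summit.Ventures.HSemireg.Wedge.HankelOuter

/-! ## §1112. Associated polynomials of general order, the Casoratian, and rank-one diagonal changes -/

/-- **THE CASORATIAN OF `q` AND THE ASSOCIATED POLYNOMIALS OF ORDER `i + 1`**: if `Q_0 = 1`, `Q_1 = X − a_{i+1}`, `Q_{n+2} = (X − a_{n+i+2}) Q_{n+1} − b_{n+i+2} Q_n`, then
`q_{m+i+2} Q_m − q_{m+i+1} Q_{m+1} = −(b_{i+1}⋯b_{m+i+1}) q_i`. [Chihara III (4.4); Van Assche 1991 §2; this file, §1112] -/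
theorem associated_casoratian {q Q : ℕ → ℝ[X]} {a b A B : ℕ → ℝ}
    (hrec : ∀ n, q (n + 2) = (Polynomial.X - C (a (n + 1))) * q (n + 1) - C (b (n + 1)) * q n)
    (hQ0 : Q 0 = 1) (hQ1 : Q 1 = Polynomial.X - C (A 0)) (hQrec : ∀ n, Q (n + 2) = (Polynomial.X - C (A (n + 1))) * Q (n + 1) - C (B (n + 1)) * Q n)
    (i : ℕ) (hA : ∀ n, A n = a (n + i + 1)) (hB : ∀ n, B n = b (n + i + 1)) (m : ℕ) :
    q (m + i + 2) * Q m - q (m + i + 1) * Q (m + 1) = -C (∏ l ∈ Finset.Ico (i + 1) (m + i + 2), b l) * q i := by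
  induction m with
  | zero =>
    have h := hrec i
    rw [zero_add, zero_add, hQ0, hQ1, hA, zero_add, show i + 1 + 1 = i + 2 by ring, Nat.Ico_succ_singleton, Finset.prod_singleton, h]
    ring
  | succ m ih =>
    have h1 := hrec (m + i + 1)
    have h2 := hQrec m
    rw [hA, hB] at h2
    rw [show m + 1 + i + 2 = m + i + 1 + 2 by ring, show m + 1 + i + 1 = m + i + 2 by ring, show m + 1 + 1 = m + 2 by ring, h1, h2,
      show m + i + 1 + 1 = m + i + 2 by ring, show m + 1 + i + 1 = m + i + 2 by ring, Finset.prod_Ico_succ_top (show i + 1 ≤ m + i + 2 by omega), C_mul]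
    have e : ((Polynomial.X - C (a (m + i + 2))) * q (m + i + 2) - C (b (m + i + 2)) * q (m + i + 1)) * Q (m + 1) -
        q (m + i + 2) * ((Polynomial.X - C (a (m + i + 2))) * Q (m + 1) - C (b (m + i + 2)) * Q m) = C (b (m + i + 2)) * (q (m + i + 2) * Q m - q (m + i + 1) * Q (m + 1)) := by ring
    rw [e, ih]
    ring

/-- **Raising one diagonal coefficient does not change `q_n` for `n ≤ i`**: `a'_i = a_i + c`, `a'_n = a_n` (`n ≠ i`), same `b` ⇒ `q'_n = q_n` for `n ≤ i`. [bookkeeping; this file, §1112] -/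
theorem rank_one_perturbation_eq_below {q q' : ℕ → ℝ[X]} {a a' b : ℕ → ℝ} (hq0 : q 0 = 1) (hq1 : q 1 = Polynomial.X - C (a 0))
    (hrec : ∀ n, q (n + 2) = (Polynomial.X - C (a (n + 1))) * q (n + 1) - C (b (n + 1)) * q n)
    (hq0' : q' 0 = 1) (hq1' : q' 1 = Polynomial.X - C (a' 0)) (hrec' : ∀ n, q' (n + 2) = (Polynomial.X - C (a' (n + 1))) * q' (n + 1) - C (b (n + 1)) * q' n)
    {i : ℕ} (ha : ∀ n, n ≠ i → a' n = a n) : ∀ n, n ≤ i → q' n = q n := by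
  have key : ∀ n, n ≤ i → q' n = q n ∧ (n + 1 ≤ i → q' (n + 1) = q (n + 1)) := by
    intro n
    induction n with
    | zero =>
      intro _
      refine ⟨by rw [hq0, hq0'], fun h1 => ?_⟩
      rw [hq1, hq1', ha 0 (by omega)]
    | succ n ih =>
      intro hn
      obtain ⟨h0, h1⟩ := ih (by omega)
      refine ⟨h1 hn, fun h2 => ?_⟩
      rw [show n + 1 + 1 = n + 2 by ring, hrec n, hrec' n, h0, h1 hn, ha (n + 1) (by omega)]
  exact fun n hn => (key n hn).1

/-- **THE RANK-ONE PERTURBATION FORMULA: `q'_{m+i+1} = q_{m+i+1} − c · q_i · Q_m`** (`Q` the associated polynomials of order `i + 1`; `a'_i = a_i + c`, all other coefficients equal).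
[Golub 1973 §5; Wilkinson Ch. 2 §41; this file, §1112] -/
theorem rank_one_perturbation_eq {q q' Q : ℕ → ℝ[X]} {a a' b A B : ℕ → ℝ} (hq0 : q 0 = 1) (hq1 : q 1 = Polynomial.X - C (a 0))
    (hrec : ∀ n, q (n + 2) = (Polynomial.X - C (a (n + 1))) * q (n + 1) - C (b (n + 1)) * q n)
    (hq0' : q' 0 = 1) (hq1' : q' 1 = Polynomial.X - C (a' 0)) (hrec' : ∀ n, q' (n + 2) = (Polynomial.X - C (a' (n + 1))) * q' (n + 1) - C (b (n + 1)) * q' n)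
    (hQ0 : Q 0 = 1) (hQ1 : Q 1 = Polynomial.X - C (A 0)) (hQrec : ∀ n, Q (n + 2) = (Polynomial.X - C (A (n + 1))) * Q (n + 1) - C (B (n + 1)) * Q n)
    {i : ℕ} (hA : ∀ n, A n = a (n + i + 1)) (hB : ∀ n, B n = b (n + i + 1)) {c : ℝ} (hc : a' i = a i + c) (ha : ∀ n, n ≠ i → a' n = a n) :
    ∀ m, q' (m + i + 1) = q (m + i + 1) - C c * q i * Q m := by
  have hbelow := rank_one_perturbation_eq_below hq0 hq1 hrec hq0' hq1' hrec' ha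
  -- the first two differences
  have hD1 : q' (i + 1) = q (i + 1) - C c * q i * Q 0 := by
    rw [hQ0, mul_one]
    rcases Nat.eq_zero_or_pos i with hi | hi
    · subst hi
      rw [zero_add, hq1, hq1', hc, hq0, C_add]; ring
    · obtain ⟨j, rfl⟩ : ∃ j, i = j + 1 := ⟨i - 1, by omega⟩
      rw [show j + 1 + 1 = j + 2 by ring, hrec j, hrec' j, hbelow j (by omega), hbelow (j + 1) le_rfl, hc, C_add]
      ring
  have hD2 : q' (i + 2) = q (i + 2) - C c * q i * Q 1 := by
    rw [hrec i, hrec' i, hD1, hbelow i le_rfl, ha (i + 1) (by omega), hQ0, hQ1, hA, zero_add]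
    ring
  have key : ∀ m, q' (m + i + 1) = q (m + i + 1) - C c * q i * Q m ∧ q' (m + i + 2) = q (m + i + 2) - C c * q i * Q (m + 1) := by
    intro m
    induction m with
    | zero => exact ⟨by rw [zero_add]; exact hD1, by rw [zero_add]; exact hD2⟩
    | succ m ih =>
      obtain ⟨h0, h1⟩ := ih
      refine ⟨by rw [show m + 1 + i + 1 = m + i + 2 by ring]; exact h1, ?_⟩
      have h2 := hQrec m
      rw [hA, hB] at h2
      rw [show m + 1 + i + 2 = m + i + 1 + 2 by ring, hrec (m + i + 1), hrec' (m + i + 1), show m + i + 1 + 1 = m + i + 2 by ring, h0, h1, ha (m + i + 2) (by omega),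
        show m + 1 + 1 = m + 2 by ring, h2, show m + 1 + i + 1 = m + i + 2 by ring]
      ring
  exact fun m => (key m).1

/-- **At a zero `ξ` of `q_{m+i+2}`: `q_{m+i+1}(ξ) · Q_{m+1}(ξ) = (b_{i+1}⋯b_{m+i+1}) · q_i(ξ)`** (the Casoratian evaluated). [Chihara III (4.4); this file, §1112] -/
theorem associated_eval_at_zero {q Q : ℕ → ℝ[X]} {a b A B : ℕ → ℝ}
    (hrec : ∀ n, q (n + 2) = (Polynomial.X - C (a (n + 1))) * q (n + 1) - C (b (n + 1)) * q n)
    (hQ0 : Q 0 = 1) (hQ1 : Q 1 = Polynomial.X - C (A 0)) (hQrec : ∀ n, Q (n + 2) = (Polynomial.X - C (A (n + 1))) * Q (n + 1) - C (B (n + 1)) * Q n)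
    (i : ℕ) (hA : ∀ n, A n = a (n + i + 1)) (hB : ∀ n, B n = b (n + i + 1)) (m : ℕ) {ξ : ℝ} (hξ : (q (m + i + 2)).eval ξ = 0) :
    (q (m + i + 1)).eval ξ * (Q (m + 1)).eval ξ = (∏ l ∈ Finset.Ico (i + 1) (m + i + 2), b l) * (q i).eval ξ := by
  have h := congrArg (eval ξ) (associated_casoratian hrec hQ0 hQ1 hQrec i hA hB m)
  simp only [eval_sub, eval_mul, eval_neg, eval_C, hξ, zero_mul, zero_sub] at h
  linarith

/-- **THE RANK-ONE SECULAR VALUE: at a zero `ξ` of `q_N` (`N = m + i + 1 ≥ i + 1`, positive `b`), `q'_N(ξ) · q_{N−1}(ξ) = −c (b_{i+1}⋯b_{N−1}) q_i(ξ)²` and `q_{N−1}(ξ) ≠ 0`.**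
[Golub 1973 §5 (secular equation); this file, §1112] -/
theorem rank_one_secular_value {q q' Q : ℕ → ℝ[X]} {a a' b A B : ℕ → ℝ} (hq0 : q 0 = 1) (hq1 : q 1 = Polynomial.X - C (a 0))
    (hrec : ∀ n, q (n + 2) = (Polynomial.X - C (a (n + 1))) * q (n + 1) - C (b (n + 1)) * q n)
    (hq0' : q' 0 = 1) (hq1' : q' 1 = Polynomial.X - C (a' 0)) (hrec' : ∀ n, q' (n + 2) = (Polynomial.X - C (a' (n + 1))) * q' (n + 1) - C (b (n + 1)) * q' n)
    (hQ0 : Q 0 = 1) (hQ1 : Q 1 = Polynomial.X - C (A 0)) (hQrec : ∀ n, Q (n + 2) = (Polynomial.X - C (A (n + 1))) * Q (n + 1) - C (B (n + 1)) * Q n)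
    (hb : ∀ j, 0 < b j) {i : ℕ} (hA : ∀ n, A n = a (n + i + 1)) (hB : ∀ n, B n = b (n + i + 1)) {c : ℝ} (hc : a' i = a i + c) (ha : ∀ n, n ≠ i → a' n = a n)
    (m : ℕ) {ξ : ℝ} (hξ : (q (m + i + 1)).eval ξ = 0) :
    (q' (m + i + 1)).eval ξ * (q (m + i)).eval ξ = -c * (∏ l ∈ Finset.Ico (i + 1) (m + i + 1), b l) * ((q i).eval ξ) ^ 2 ∧ (q (m + i)).eval ξ ≠ 0 := by
  have h1 := rank_one_perturbation_eq hq0 hq1 hrec hq0' hq1' hrec' hQ0 hQ1 hQrec hA hB hc ha m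
  have hne : (q (m + i)).eval ξ ≠ 0 := fun h0 => recurrence_no_common_root hq0 hq1 hrec hb (m + i) h0 hξ
  refine ⟨?_, hne⟩
  rcases m with _ | m
  · rw [zero_add] at hξ h1 ⊢
    rw [h1, eval_sub, eval_mul, eval_mul, eval_C, hξ, zero_sub, hQ0, eval_one, Finset.Ico_self, Finset.prod_empty]
    ring
  · have h2 := associated_eval_at_zero hrec hQ0 hQ1 hQrec i hA hB m (by rw [show m + i + 2 = m + 1 + i + 1 by ring]; exact hξ)
    rw [show m + 1 + i + 1 = m + i + 2 by ring] at h1 hξ ⊢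
    rw [show m + 1 + i = m + i + 1 by ring, h1, eval_sub, eval_mul, eval_mul, eval_C, hξ, zero_sub]
    calc -(c * (q i).eval ξ * (Q (m + 1)).eval ξ) * (q (m + i + 1)).eval ξ = -(c * (q i).eval ξ) * ((q (m + i + 1)).eval ξ * (Q (m + 1)).eval ξ) := by ring
      _ = -c * (∏ l ∈ Finset.Ico (i + 1) (m + i + 2), b l) * ((q i).eval ξ) ^ 2 := by rw [h2]; ring

/-- **A ZERO OF `q_N` SURVIVES THE RANK-ONE CHANGE EXACTLY WHEN `q_i` VANISHES THERE: `q'_N(ξ) = 0 ↔ q_i(ξ) = 0`** (`ξ` a zero of `q_N`, `N ≥ i + 1`, `c ≠ 0`, `b > 0`). [Golub 1973 §5;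
Wilkinson Ch. 2 §40; this file, §1112] -/
theorem rank_one_fixed_zero_iff {q q' Q : ℕ → ℝ[X]} {a a' b A B : ℕ → ℝ} (hq0 : q 0 = 1) (hq1 : q 1 = Polynomial.X - C (a 0))
    (hrec : ∀ n, q (n + 2) = (Polynomial.X - C (a (n + 1))) * q (n + 1) - C (b (n + 1)) * q n)
    (hq0' : q' 0 = 1) (hq1' : q' 1 = Polynomial.X - C (a' 0)) (hrec' : ∀ n, q' (n + 2) = (Polynomial.X - C (a' (n + 1))) * q' (n + 1) - C (b (n + 1)) * q' n)
    (hQ0 : Q 0 = 1) (hQ1 : Q 1 = Polynomial.X - C (A 0)) (hQrec : ∀ n, Q (n + 2) = (Polynomial.X - C (A (n + 1))) * Q (n + 1) - C (B (n + 1)) * Q n)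
    (hb : ∀ j, 0 < b j) {i : ℕ} (hA : ∀ n, A n = a (n + i + 1)) (hB : ∀ n, B n = b (n + i + 1)) {c : ℝ} (hc : a' i = a i + c) (hc0 : c ≠ 0) (ha : ∀ n, n ≠ i → a' n = a n)
    (m : ℕ) {ξ : ℝ} (hξ : (q (m + i + 1)).eval ξ = 0) :
    (q' (m + i + 1)).eval ξ = 0 ↔ (q i).eval ξ = 0 := by
  obtain ⟨h1, -⟩ := rank_one_secular_value hq0 hq1 hrec hq0' hq1' hrec' hQ0 hQ1 hQrec hb hA hB hc ha m hξ
  have hprod : 0 < ∏ l ∈ Finset.Ico (i + 1) (m + i + 1), b l := Finset.prod_pos fun l _ => hb l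
  constructor
  · intro h0
    rw [h0, zero_mul] at h1
    have : c * (∏ l ∈ Finset.Ico (i + 1) (m + i + 1), b l) * ((q i).eval ξ) ^ 2 = 0 := by linarith
    rcases mul_eq_zero.1 this with h | h
    · rcases mul_eq_zero.1 h with h' | h'
      · exact absurd h' hc0
      · exact absurd h' hprod.ne'
    · exact pow_eq_zero_iff (two_ne_zero) |>.1 h
  · intro h0
    have h3 := rank_one_perturbation_eq hq0 hq1 hrec hq0' hq1' hrec' hQ0 hQ1 hQrec hA hB hc ha m
    rw [h3, eval_sub, eval_mul, eval_mul, eval_C, hξ, h0, mul_zero, zero_mul, sub_zero]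

/-- **STRICT RANK-ONE INTERLACING: if `q_i` vanishes at no zero of `q_{t+1}` then raising `a_i` by `c > 0` gives `x_k < y_k < x_{k+1}`** (`i ≤ t`). [Wilkinson Ch. 2 §§39–41; Golub 1973 §5;
this file, §1112] -/
theorem zeros_rank_one_strict_interlace {q q' Q : ℕ → ℝ[X]} {a a' b A B : ℕ → ℝ} (hq0 : q 0 = 1) (hq1 : q 1 = Polynomial.X - C (a 0))
    (hrec : ∀ n, q (n + 2) = (Polynomial.X - C (a (n + 1))) * q (n + 1) - C (b (n + 1)) * q n)
    (hq0' : q' 0 = 1) (hq1' : q' 1 = Polynomial.X - C (a' 0)) (hrec' : ∀ n, q' (n + 2) = (Polynomial.X - C (a' (n + 1))) * q' (n + 1) - C (b (n + 1)) * q' n)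
    (hQ0 : Q 0 = 1) (hQ1 : Q 1 = Polynomial.X - C (A 0)) (hQrec : ∀ n, Q (n + 2) = (Polynomial.X - C (A (n + 1))) * Q (n + 1) - C (B (n + 1)) * Q n)
    (hb : ∀ j, 0 < b j) {i : ℕ} (hA : ∀ n, A n = a (n + i + 1)) (hB : ∀ n, B n = b (n + i + 1)) {c : ℝ} (hc : a' i = a i + c) (hc0 : 0 < c) (ha : ∀ n, n ≠ i → a' n = a n)
    {t : ℕ} (hit : i ≤ t) {x y : Fin (t + 1) → ℝ} (hx : StrictMono x) (hxq : q (t + 1) = ∏ j, (Polynomial.X - C (x j))) (hy : StrictMono y) (hyq : q' (t + 1) = ∏ j, (Polynomial.X - C (y j)))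
    (hqi : ∀ k, (q i).eval (x k) ≠ 0) (k : Fin (t + 1)) : x k < y k ∧ ∀ hk : (k : ℕ) + 1 ≤ t, y k < x ⟨k + 1, by omega⟩ := by
  obtain ⟨m, hm⟩ : ∃ m, t + 1 = m + i + 1 := ⟨t - i, by omega⟩
  have hxr : ∀ j, (q (m + i + 1)).eval (x j) = 0 := fun j => by
    rw [← hm, hxq, eval_prod]; exact Finset.prod_eq_zero (Finset.mem_univ j) (by rw [eval_sub, eval_X, eval_C, sub_self])
  have hyr : ∀ j, (q' (t + 1)).eval (y j) = 0 := fun j => by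
    rw [hyq, eval_prod]; exact Finset.prod_eq_zero (Finset.mem_univ j) (by rw [eval_sub, eval_X, eval_C, sub_self])
  -- no zero of `q_{t+1}` is a zero of `q'_{t+1}`
  have hne : ∀ j j', y j' ≠ x j := fun j j' h => by
    have h0 : (q' (m + i + 1)).eval (x j) = 0 := by rw [← hm, ← h]; exact hyr j'
    exact hqi j ((rank_one_fixed_zero_iff hq0 hq1 hrec hq0' hq1' hrec' hQ0 hQ1 hQrec hb hA hB hc hc0.ne' ha m (hxr j)).1 h0)
  obtain ⟨h1, h2⟩ := zeros_rank_one_interlace hq0 hq1 hrec hq0' hq1' hrec' hb (i₀ := i) (by rw [hc]; exact le_add_of_nonneg_right hc0.le) ha hx hxq hy hyq k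
  exact ⟨lt_of_le_of_ne h1 (hne k k).symm, fun hk => lt_of_le_of_ne (h2 hk) (hne _ k)⟩

/-- **The example `a = (0, a_1, 0)`: `q_3 = X · (X² − a_1 X − (b_1 + b_2))`, so `q_3(0) = 0` WHATEVER `a_1` is.** [this file, §1112] -/
theorem rank_one_example_eval_zero {q : ℕ → ℝ[X]} {a b : ℕ → ℝ} (hq0 : q 0 = 1) (hq1 : q 1 = Polynomial.X - C (a 0))
    (hrec : ∀ n, q (n + 2) = (Polynomial.X - C (a (n + 1))) * q (n + 1) - C (b (n + 1)) * q n) (ha0 : a 0 = 0) (ha2 : a 2 = 0) :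
    q 3 = Polynomial.X * (Polynomial.X ^ 2 - C (a 1) * Polynomial.X - C (b 1 + b 2)) ∧ (q 3).eval 0 = 0 := by
  have h3 : q 3 = Polynomial.X * (Polynomial.X ^ 2 - C (a 1) * Polynomial.X - C (b 1 + b 2)) := by
    rw [show (3 : ℕ) = 1 + 2 from rfl, hrec 1, show 1 + 1 = 0 + 2 from rfl, hrec 0, hq1, hq0, ha0, show (1 : ℕ) + 1 = 2 from rfl, ha2, C_0, C_add]
    ring
  refine ⟨h3, ?_⟩
  rw [h3, eval_mul, eval_X, zero_mul]

/-- **… and `0` is the MIDDLE zero of `q_3` (positive `b`): the rank-one interlacing `x_1 ≤ y_1 ≤ x_2` of N346 is attained at `y_1 = x_1 = 0` when `a_1` is raised — a single diagonal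
coefficient can increase strictly without moving a zero** (contrast N323 `zeros_strictMono_diagonal`, where ALL `a_i` increase). [this file, §1112] -/
theorem rank_one_example_middle_zero {q : ℕ → ℝ[X]} {a b : ℕ → ℝ} (hq0 : q 0 = 1) (hq1 : q 1 = Polynomial.X - C (a 0))
    (hrec : ∀ n, q (n + 2) = (Polynomial.X - C (a (n + 1))) * q (n + 1) - C (b (n + 1)) * q n) (hb : ∀ j, 0 < b j) (ha0 : a 0 = 0) (ha2 : a 2 = 0)
    {x : Fin 3 → ℝ} (hx : StrictMono x) (hxq : q 3 = ∏ j, (Polynomial.X - C (x j))) : x 1 = 0 := by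
  obtain ⟨h3, -⟩ := rank_one_example_eval_zero hq0 hq1 hrec ha0 ha2
  -- `q_3` in both forms, evaluated
  have hev : ∀ z : ℝ, z * (z ^ 2 - a 1 * z - (b 1 + b 2)) = (z - x 0) * (z - x 1) * (z - x 2) := fun z => by
    have h := congrArg (eval z) (h3.symm.trans hxq)
    rw [eval_prod, Fin.prod_univ_three] at h
    simpa only [eval_mul, eval_sub, eval_pow, eval_X, eval_C] using h
  have hb12 : 0 < b 1 + b 2 := add_pos (hb 1) (hb 2)
  have h01 : x 0 < x 1 := hx (by decide)
  have h12 : x 1 < x 2 := hx (by decide)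
  -- some zero is `0`
  have h0 := hev 0
  rw [zero_mul, zero_sub, zero_sub, zero_sub] at h0
  have hx0 : x 0 = 0 ∨ x 1 = 0 ∨ x 2 = 0 := by
    have : x 0 * x 1 * x 2 = 0 := by linarith
    rcases mul_eq_zero.1 this with h | h
    · rcases mul_eq_zero.1 h with h' | h'
      · exact Or.inl h'
      · exact Or.inr (Or.inl h')
    · exact Or.inr (Or.inr h)
  rcases hx0 with h | h | h
  · -- `x_0 = 0`: then `x_1, x_2 > 0` are the zeros of the quadratic, whose product `−(b_1 + b_2)` is negative
    exfalso
    have e1 := hev (x 1)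
    have e2 := hev (x 2)
    rw [sub_self, mul_zero, zero_mul] at e1
    rw [sub_self, mul_zero] at e2
    have hx1 : 0 < x 1 := by rw [← h]; exact h01
    have hx2 : 0 < x 2 := hx1.trans h12
    have f1 : x 1 ^ 2 - a 1 * x 1 - (b 1 + b 2) = 0 := by
      rcases mul_eq_zero.1 e1 with h' | h'
      · exact absurd h' hx1.ne'
      · exact h'
    have f2 : x 2 ^ 2 - a 1 * x 2 - (b 1 + b 2) = 0 := by
      rcases mul_eq_zero.1 e2 with h' | h'
      · exact absurd h' hx2.ne'
      · exact h'
    have f3 : (x 2 - x 1) * (x 1 + x 2 - a 1) = 0 := by nlinarith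
    have f4 : x 1 + x 2 - a 1 = 0 := by
      rcases mul_eq_zero.1 f3 with h' | h'
      · exact absurd h' (sub_ne_zero.2 h12.ne')
      · exact h'
    nlinarith [mul_pos hx1 hx2]
  · exact h
  · -- `x_2 = 0`: then `x_0, x_1 < 0`, same contradiction
    exfalso
    have e0 := hev (x 0)
    have e1 := hev (x 1)
    rw [sub_self, zero_mul, zero_mul] at e0
    rw [sub_self, mul_zero, zero_mul] at e1
    have hx1 : x 1 < 0 := by rw [← h]; exact h12
    have hx0' : x 0 < 0 := h01.trans hx1
    have f0 : x 0 ^ 2 - a 1 * x 0 - (b 1 + b 2) = 0 := by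
      rcases mul_eq_zero.1 e0 with h' | h'
      · exact absurd h' hx0'.ne
      · exact h'
    have f1 : x 1 ^ 2 - a 1 * x 1 - (b 1 + b 2) = 0 := by
      rcases mul_eq_zero.1 e1 with h' | h'
      · exact absurd h' hx1.ne
      · exact h'
    have f3 : (x 1 - x 0) * (x 0 + x 1 - a 1) = 0 := by nlinarith
    have f4 : x 0 + x 1 - a 1 = 0 := by
      rcases mul_eq_zero.1 f3 with h' | h'
      · exact absurd h' (sub_ne_zero.2 h01.ne')
      · exact h'
    nlinarith [mul_pos_of_neg_of_neg hx0' hx1]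

end Summit.Ventures.HSemireg.Wedge.HankelOuter
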